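import Mathlib
import Summits.Ventures.HodgeRepro2.Hypothesis

/-!
# T4Isometry — sub-claim B1 (the group + hermitian space + signatures): the isometries of Lemma B1.4.1

Kernel annex of route/T4-B1-p3.md, Lemma B1.4.1 (i)–(ii) and Lemma B1.2.3 (cell pub-hodge-repro2,
owner p3). The hermitian forms used there are diagonal, H_α := diag(1, 1, α) with α in the fixed field
of the CM involution ρ, and the local isometries «diag(1, 1, x^{-1})» between H_α and H_{α/N(x)},
N(x) = x·ρ(x), are the matrix identity proved here against p2's conventions (`conjTransposeK`,
`IsHermitianForm`, `unitaryGroup` of Hypothesis.lean; column vectors, g* H g). Consequences: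
* `isometric_diagonal_of_isNorm`: if α = x·ρ(x) is a norm, H_α is isometric to H_1 = I₃ — Lemma
  B1.4.1 (i): at every place where α is a local norm, W_v ≅ V_v; and (ii): if α/a₀ = N(y), H_α ≅ H_{a₀}.
* `isHermitianForm_diagonalForm`: H_α is hermitian for ρ α = α (Lemma B1.2.3, Lemma B1.4.1).
* `det_diagonalForm`: det H_α = α — the «hermitian determinant» of Def. C.3 / Gross §3 in the
  standard basis (Lemma B1.2.3).
* `det_conj_eq_norm_mul_det`: under a change of basis P the determinant is multiplied by
  det P · ρ(det P) = N(det P) — the basis-independence of the determinant class (Lemma B1.2.3).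
The statements are over the CM field K itself; at a place v the same identities hold verbatim in
F_v (they are polynomial identities in the entries), which is how Lemma B1.4.1 uses them.
Axioms: standard.
-/

namespace Summit.Ventures.HodgeRepro2.T4Isometry

open Summit.Ventures.HodgeRepro2.ShimuraData Matrix

variable {K : Type*} [Field K] [NumberField K] [NumberField.IsCMField K]

/-- The diagonal hermitian form diag(1, 1, α) of Lemmas B1.2.3 / B1.4.1. -/
def diagonalForm (α : K) : Matrix (Fin 3) (Fin 3) K := diagonal ![1, 1, α]

/-- The change-of-basis matrix diag(1, 1, x⁻¹) of Lemma B1.4.1 (i)–(ii). -/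
def scaleThird (x : K) : Matrix (Fin 3) (Fin 3) K := diagonal ![1, 1, x⁻¹]

/-- ρ-conjugate transpose of a diagonal matrix is the diagonal matrix of the ρ-conjugates. -/
theorem conjTransposeK_diagonal (d : Fin 3 → K) :
    conjTransposeK K (diagonal d) = diagonal (fun i => ρ K (d i)) := by
  unfold conjTransposeK
  rw [diagonal_map (map_zero (ρ K)), diagonal_transpose]

/-- diag(1, 1, α) is a hermitian form when α is fixed by ρ (α ∈ K⁺) — Lemma B1.2.3. -/
theorem isHermitianForm_diagonalForm (α : K) (hα : ρ K α = α) :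
    IsHermitianForm K (diagonalForm α) := by
  unfold IsHermitianForm diagonalForm
  rw [conjTransposeK_diagonal]
  congr 1
  funext i
  fin_cases i <;> simp [hα]

omit [NumberField K] [NumberField.IsCMField K] in
/-- det diag(1, 1, α) = α: the hermitian determinant of Lemma B1.2.3 in the standard basis. -/
theorem det_diagonalForm (α : K) : (diagonalForm α).det = α := by
  unfold diagonalForm
  rw [det_diagonal, Fin.prod_univ_three]
  simp

/-- The matrix identity behind Lemma B1.4.1 (i)–(ii): diag(1, 1, x⁻¹)* · diag(1, 1, α) ·
diag(1, 1, x⁻¹) = diag(1, 1, α / (x·ρ(x))) for x ≠ 0. -/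
theorem conjTransposeK_scaleThird_mul (α x : K) (hx : x ≠ 0) :
    conjTransposeK K (scaleThird x) * diagonalForm α * scaleThird x
      = diagonalForm (α / (x * ρ K x)) := by
  unfold scaleThird diagonalForm
  rw [conjTransposeK_diagonal, diagonal_mul_diagonal, diagonal_mul_diagonal]
  congr 1
  funext i
  have hρx : ρ K x ≠ 0 := (map_ne_zero (ρ K)).mpr hx
  fin_cases i
  · simp
  · simp
  · simp
    field_simp

/-- Change of basis: for any P, det(P* H P) = N(det P) · det H with N(z) = z·ρ(z) — the
basis-independence of the determinant class of Lemma B1.2.3 (Def. C.3; Gross §3). -/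
theorem det_conj_eq_norm_mul_det {m : ℕ} (H P : Matrix (Fin m) (Fin m) K) :
    (conjTransposeK K P * H * P).det = (P.det * ρ K P.det) * H.det := by
  unfold conjTransposeK
  have hmap : (P.map ⇑(ρ K)).det = ρ K P.det := by
    rw [AlgEquiv.map_det (ρ K) P]
    rfl
  rw [det_mul, det_mul, det_transpose, hmap]
  ring

/-- Lemma B1.4.1 (i): if α = x·ρ(x) is a norm, the forms diag(1, 1, α) and I₃ = diag(1, 1, 1) are
isometric, the isometry being diag(1, 1, x⁻¹). -/
theorem isometric_diagonal_of_isNorm (α x : K) (hx : x ≠ 0) (hα : α = x * ρ K x) :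
    conjTransposeK K (scaleThird x) * diagonalForm α * scaleThird x = diagonalForm 1 := by
  rw [conjTransposeK_scaleThird_mul α x hx, hα]
  congr 1
  exact div_self (mul_ne_zero hx ((map_ne_zero (ρ K)).mpr hx))

/-- Lemma B1.4.1 (ii): if α / a₀ = y·ρ(y) is a norm, diag(1, 1, α) and diag(1, 1, a₀) are isometric
via diag(1, 1, y⁻¹). -/
theorem isometric_diagonal_of_div_isNorm (α a₀ y : K) (hy : y ≠ 0) (ha₀ : a₀ ≠ 0)
    (h : α / a₀ = y * ρ K y) :
    conjTransposeK K (scaleThird y) * diagonalForm α * scaleThird y = diagonalForm a₀ := by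
  have hα : α ≠ 0 := by
    intro h0
    rw [h0, zero_div] at h
    exact mul_ne_zero hy ((map_ne_zero (ρ K)).mpr hy) h.symm
  rw [conjTransposeK_scaleThird_mul α y hy]
  congr 1
  rw [← h]
  field_simp

omit [NumberField K] [NumberField.IsCMField K] in
/-- The isometry diag(1, 1, x⁻¹) is invertible (x ≠ 0): it is a genuine change of basis. -/
theorem det_scaleThird (x : K) : (scaleThird x).det = x⁻¹ := by
  unfold scaleThird
  rw [det_diagonal, Fin.prod_univ_three]
  simp

end Summit.Ventures.HodgeRepro2.T4Isometry
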